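import Mathlib
import Summits.CriticalPhenomena.PercolationContinuityZ3.Theorems.PercNearOneGluingNoHeavyLowerTailCondCILSteinerPathBase
import HarnessLib

/-!
# `NoHeavyLowerTail` (stmt-CriticalPhenomena-4575) — spider legs are attached INSIDE THEIR OWN PAIRS (up to a null set)

Seat `prim-cplus-engine` gen 7, 2026-08-19 (`--supports stmt-CriticalPhenomena-4575`).  No definitions, no named facts, no sorries.
Technical companion of `…MarkovFirstEdgeSpiderUniform.lean`: it is what discharges the hypothesis `μ(o ↮ A) ≤ e^{−Λ}` of
`MarkovFirstEdge.spider_lowerTail_le_uniform` for spiders with VERTEX-DISJOINT legs (`…SpiderClass.lean`).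

For an injective Steiner path `p : Fin (k+1) → Fin n` off `A` (positive-weight non-relay neighbours of `p i` other than `p i` are path
neighbours) write `D(p)` for the finite set of pairs `s(p i, v)` with `v` a relay or a path vertex — the LEG PAIRS.  Then:

* `SpiderAttach.firstRelay_within` — outside the null event "some weight-`0` pair is open", an open walk from a path vertex to a relay yields a
  relay `a` reached from the start INSIDE `ω ∩ D(p)` (the walk runs along path pairs and leaves through a hair).
* `SpiderAttach.attach_off_le_attach_within` — for a leg `p` of an observer `o` (`p 0`'s only extra non-relay neighbour is `o`):
      `μ_w(ω ∖ s(o, p 0) ∈ {p 0 ↔ A}) ≤ μ_w(ω ∩ D(p) ∈ {p 0 ↔ A})`,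
  i.e. the attachment probability of the leg start in `G ∖ s(o, p 0)` is at most the probability that it is attached using leg pairs only.
  (The converse inequality is plain monotonicity; so the two agree.)  The right-hand event is determined by `D(p)`, which is what makes legs with
  disjoint vertex sets independent.
-/

namespace Summit.CriticalPhenomena.PercolationContinuityZ3.Theorems

open MeasureTheory Set
open Literature.Probability.LatticeModels (prodBernoulli prodBernoulli_setOf_exists_mem_eq_zero)
open Literature.Probability.Percolation

noncomputable section
open Classical

variable {n : ℕ}

namespace SpiderAttach

/-- **First relay, inside the leg pairs.**  Steiner path `p` (positive-weight non-relay neighbours of `p i` other than `p i` are path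
neighbours), `ω` opening no pair of weight `0`, and a finite pair set `D` containing every `s(p i, a)` (`a ∈ A`) and every `s(p i, p l)`.  An open
walk from a path vertex `u` to a relay gives a relay `a` with `u ↔ a` in the configuration `ω ∩ D`. [this work] -/
theorem firstRelay_within (w : Sym2 (Fin n) → unitInterval) (A : Finset (Fin n)) {k : ℕ}
    (p : Fin (k + 1) → Fin n) (hpA : ∀ i, p i ∉ A)
    (hpath : ∀ (i : Fin (k + 1)) (v : Fin n), v ∉ A → v ≠ p i → 0 < (w s(p i, v) : ℝ) →
      ∃ l : Fin (k + 1), v = p l ∧ (l.val = i.val + 1 ∨ i.val = l.val + 1))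
    (D : Set (Sym2 (Fin n))) (hDA : ∀ i, ∀ a ∈ A, s(p i, a) ∈ D) (hDp : ∀ i l, s(p i, p l) ∈ D)
    {ω : BondConfig (Fin n)} (hω : ∀ e ∈ ω, (w e : ℝ) ≠ 0) :
    ∀ {u x : Fin n} (_ : (openGraph ω).Walk u x), (∃ i, u = p i) → x ∈ A →
      ∃ a ∈ A, (openGraph (ω ∩ D)).Reachable u a
  | _, _, .nil => fun ⟨i, hi⟩ hx => absurd hx (hi ▸ hpA i)
  | u, x, .cons (v := v) hadj q => fun ⟨i, hi⟩ hx => by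
      have huv : s(u, v) ∈ ω ∧ u ≠ v := (openGraph_adj ω u v).1 hadj
      by_cases hvA : v ∈ A
      · refine ⟨v, hvA, SimpleGraph.Adj.reachable ?_⟩
        rw [openGraph_adj]
        exact ⟨⟨huv.1, hi ▸ hDA i v hvA⟩, huv.2⟩
      · have hpos : 0 < (w s(p i, v) : ℝ) := by
          rw [← hi]
          exact lt_of_le_of_ne (w s(u, v)).2.1 (Ne.symm (hω _ huv.1))
        obtain ⟨l', hvl', -⟩ := hpath i v hvA (fun h => huv.2 (hi.trans h.symm)) hpos
        obtain ⟨a, haA, hva⟩ := firstRelay_within w A p hpA hpath D hDA hDp hω q ⟨l', hvl'⟩ hx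
        refine ⟨a, haA, SimpleGraph.Reachable.trans (SimpleGraph.Adj.reachable ?_) hva⟩
        rw [openGraph_adj]
        exact ⟨⟨huv.1, hi ▸ hvl' ▸ hDp i l'⟩, huv.2⟩

/-- **Attachment off the pair back to `o` ≤ attachment inside the leg pairs.**  `p` a leg of the observer `o`: injective Steiner path off `A`
with `p 0`'s positive-weight non-relay neighbours among `o` and `p 1`, and those of `p i` (`i ≥ 1`) among the path neighbours; `o` not on the
leg; `D ∌ s(o, p 0)` a pair set containing the leg pairs.  Then
`μ_w(ω ∖ s(o,p 0) ∈ ⋃_a {p 0 ↔ a}) ≤ μ_w(ω ∩ D ∈ ⋃_a {p 0 ↔ a})`. [this work] -/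
theorem attach_off_le_attach_within (w : Sym2 (Fin n) → unitInterval) (A : Finset (Fin n)) (o : Fin n) {k : ℕ}
    (p : Fin (k + 1) → Fin n) (hpA : ∀ i, p i ∉ A)
    (hpath : ∀ (i : Fin (k + 1)) (v : Fin n), v ∉ A → v ≠ p i → 0 < (w s(p i, v) : ℝ) →
      (v = o ∧ i = 0) ∨ ∃ l : Fin (k + 1), v = p l ∧ (l.val = i.val + 1 ∨ i.val = l.val + 1))
    (D : Set (Sym2 (Fin n))) (hDA : ∀ i, ∀ a ∈ A, s(p i, a) ∈ D) (hDp : ∀ i l, s(p i, p l) ∈ D) :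
    (prodBernoulli w).real {ω : BondConfig (Fin n) | ω \ {s(o, p 0)} ∈ ⋃ a ∈ A, (openConn (p 0) a : Set (BondConfig (Fin n)))} ≤
      (prodBernoulli w).real {ω : BondConfig (Fin n) | ω ∩ D ∈ ⋃ a ∈ A, (openConn (p 0) a : Set (BondConfig (Fin n)))} := by
  set μ := prodBernoulli w with hμ
  set e : Sym2 (Fin n) := s(o, p 0) with he
  set Z : Finset (Sym2 (Fin n)) := Finset.univ.filter fun f : Sym2 (Fin n) => (w f : ℝ) = 0 with hZ
  have hnull : μ.real {ω : BondConfig (Fin n) | ∃ f ∈ Z, f ∈ ω} = 0 := by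
    rw [measureReal_def, prodBernoulli_setOf_exists_mem_eq_zero w Z fun f hf => (Finset.mem_filter.1 hf).2,
      ENNReal.toReal_zero]
  -- the Steiner-path hypothesis for the weights with the pair `e` closed
  set w' := pinW w ({e} : Set (Sym2 (Fin n))) ∅ with hw'
  have hpath' := ObserverUnionBoundG.legs_pinW_of_legs w A o (rfl : p 0 = p 0) hpath
  have hsub : {ω : BondConfig (Fin n) | ω \ {e} ∈ ⋃ a ∈ A, (openConn (p 0) a : Set (BondConfig (Fin n)))} ⊆
      {ω : BondConfig (Fin n) | ω ∩ D ∈ ⋃ a ∈ A, (openConn (p 0) a : Set (BondConfig (Fin n)))} ∪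
        {ω : BondConfig (Fin n) | ∃ f ∈ Z, f ∈ ω} := by
    intro ω hω
    by_cases hz : ∃ f ∈ Z, f ∈ ω
    · exact Or.inr hz
    left
    rw [mem_setOf_eq, Set.mem_iUnion₂] at hω ⊢
    obtain ⟨x, hxA, hx⟩ := hω
    -- no pair of `w'`-weight `0` is open in `ω \ {e}`
    have hω' : ∀ f ∈ ω \ {e}, (w' f : ℝ) ≠ 0 := by
      intro f hf h0
      have hfe : f ∉ ({e} : Set (Sym2 (Fin n))) := hf.2
      rw [hw', pinW_apply_of_not_mem w ∅ hfe] at h0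
      exact hz ⟨f, Finset.mem_filter.2 ⟨Finset.mem_univ _, h0⟩, hf.1⟩
    obtain ⟨q⟩ := (hx : (openGraph (ω \ {e})).Reachable (p 0) x)
    obtain ⟨a, haA, hpa⟩ := firstRelay_within w' A p hpA hpath' D hDA hDp hω' q ⟨0, rfl⟩ hxA
    refine ⟨a, haA, ?_⟩
    have hmono : openGraph ((ω \ {e}) ∩ D) ≤ openGraph (ω ∩ D) :=
      openGraph_mono (Set.inter_subset_inter_left D (fun f hf => hf.1))
    exact (hpa.mono hmono : (openGraph (ω ∩ D)).Reachable (p 0) a)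
  calc μ.real {ω : BondConfig (Fin n) | ω \ {e} ∈ ⋃ a ∈ A, (openConn (p 0) a : Set (BondConfig (Fin n)))}
      ≤ μ.real ({ω : BondConfig (Fin n) | ω ∩ D ∈ ⋃ a ∈ A, (openConn (p 0) a : Set (BondConfig (Fin n)))} ∪
          {ω : BondConfig (Fin n) | ∃ f ∈ Z, f ∈ ω}) := measureReal_mono hsub (measure_ne_top _ _)
    _ ≤ μ.real {ω : BondConfig (Fin n) | ω ∩ D ∈ ⋃ a ∈ A, (openConn (p 0) a : Set (BondConfig (Fin n)))} +
          μ.real {ω : BondConfig (Fin n) | ∃ f ∈ Z, f ∈ ω} := measureReal_union_le _ _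
    _ = _ := by rw [hnull, add_zero]

/-- The event "attached inside the pair set `D`" reads only the pairs of `D`. [folklore] -/
theorem determinedBy_attach_within (A : Finset (Fin n)) (x : Fin n) (D : Set (Sym2 (Fin n))) :
    DeterminedBy {ω : BondConfig (Fin n) | ω ∩ D ∈ ⋃ a ∈ A, (openConn x a : Set (BondConfig (Fin n)))} D := by
  rw [determinedBy_iff]
  intro ω ω' h
  simp only [mem_setOf_eq, h]

end SpiderAttach

end

end Summit.CriticalPhenomena.PercolationContinuityZ3.Theorems
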